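import Literature.AlgebraicGeometry.Motives.LogSmoothDegeneration
import Literature.AlgebraicGeometry.Motives.FamiliesVHS
import HarnessLib

/-!
# Boundary families at a depth-one (type II) cusp: the interface

Topic: `Literature/AlgebraicGeometry/Motives` (definition request `TypeIIBoundaryFamily` of route
KulikovCuspKugaSatake of the Hodge conjecture, to type the interior seams K1 `AnchoredBoundaryFamily`
and K3 `CriterionDischarge` of `stub_cuspEngine` in `Cruxes/CuspStep/Lines/birth.lean`).

A HYPOTHESIS STRUCTURE (posited data + compatibility axioms; nothing is asserted to exist), in the
chart currency of that line (`f : 𝒮 ⟶ M` a family over a quasi-projective base standing for a level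
cover of the lattice-polarized period space `M_T`, cf. `IsPolarizedK3Chart` there): for an interior
family `g : 𝒳 ⟶ M` of complex varieties (intended: the fibre product `𝒮 ×_M 𝒜 ×_M 𝒜` of the
universal K3 family with the Kuga–Satake abelian scheme, or any smooth projective family) and a
relative dimension `n`, a `TypeIIBoundaryFamily B g n` records

* a compactification `M ↪ M̄` and a smooth irreducible boundary chart `U → M̄ ∖ M` (intended: an
  étale open of the open stratum of the type II boundary divisor `B_II(I)` of a toroidal
  compactification, `I ⊂ T` the isotropic plane of the cusp);
* a flat proper boundary family `π : Y ⟶ U` (intended: the d-semistable, `K`-trivial snc varieties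
  `Y_{0,b}` = small resolution of (Kulikov type II surface) × (Mumford degeneration of the
  Kuga–Satake variety), `b ∈ U`);
* through every complex point `b` of `U`, a non-empty type of transversal ARCS: a pointed curve
  `(C, o) → M̄` hitting the boundary at `o ↦ b` and the interior elsewhere (`c ↦ m a c ∈ M(ℂ)`),
  carrying a semistable degeneration `D a : LogSmoothDegeneration C o n` (de Jong 1996, 2.16, the
  tree's `Motives.LogSmoothDegeneration`) whose special fibre is `Y_b` and whose nearby fibres are
  the interior fibres `𝒳_{m a c}` — "the boundary family restricts on transversal arcs to the
  (Kulikov type II model) × (Mumford model)";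
* the limit cohomology at `b`: `ℚ`-spaces `H^i_lim(b)` with the specialization map
  `sp : H^i(Y_b) → H^i_lim(b)`, the identifications `ψ : H^i(𝒳_{m a c}) ≃ H^i_lim(b)` of the nearby
  fibres along each arc, and the limit `lim : H^i(𝒳) → H^i_lim(b)` of the (flat, monodromy
  invariant) fibre classes of a global class of the interior total space;
* the two compatibilities that make "sp of a flat limit = limit of the flat class" a theorem
  (`sp_toSpecialFibre_eq_lim`): Clemens–Schmid — for a class `z` on the total space of an arc model,
  `sp (z|_{Y_b}) = ψ (z|_{nearby fibre})` (Morrison 1984, §2–§3: the retraction `r : 𝔛 → 𝔛₀` with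
  `r^*` an isomorphism and `i_t^* : H^m(𝔛) → H^m(𝔛_t) = H^m_lim`) — and `ψ (x|_{𝒳_{m a c}}) = lim x`
  for global `x` (restrictions of global classes are flat sections, Deligne, Hodge II, 4.1.1; the
  tree's `GeometricVHSData.restrict_mem_flatSections`);
* the transcendental-content projector `tProj` on `H^i_lim(b)` (intended: the Künneth projector onto
  `T_lim ⊗ H^{i-2}_lim(A × A)`; only idempotence is recorded).

All cohomology is `B.W` of a Betti–Hodge datum `B` (singular cohomology of complex points, defined
for every `ℂ`-scheme, smooth or not), as everywhere on the route.

## The printed constructions this interface abstracts (what an honest inhabitant is)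

K3 side. Alexeev–Engel, *Compact moduli of K3 surfaces* (arXiv numbering): Def. 3.1 "A Kulikov model
`X → (C, 0)` is an analytic extension of `X* → C*` for which `X` is smooth, `K_X ∼_C 0`, and `X₀` has
reduced normal crossings with all components algebraic … Type II [if `X₀`] has double curves but no
triple points"; Thm. 3.2 (Kulikov, Persson–Pinkham: existence after finite base change and
bimeromorphic modification); Prop. 3.4 and the Enriques–Kodaira remark after it (type II: "the two
ends … are rational surfaces with smooth elliptic anticanonical double curve, and the intermediate
components are elliptic ruled surfaces"); Thm. 3.8 (Friedman 1983: d-semistability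
`𝓔xt¹(Ω_{X₀}, 𝒪_{X₀}) = 𝒪_{(X₀)_sing}` characterises smoothable `X₀`); Thm. 3.17 (type II ⟺ `N² = 0`,
`N ≠ 0`); Def. 3.19 (the isotropic lattice `I`, rank 2 in type II); Def. 4.19 "Let `𝒳 → S` be a
family of d-semistable Kulikov surfaces of Types I + II … over a smooth base `S`. Suppose furthermore
that the discriminant locus `Δ ⊂ S` is a smooth divisor" — THIS is the shape posited here
(`U = Δ`, `Y = 𝒳|_Δ`, arcs = curves in `S` transversal to `Δ`); Thm. 4.20 (the mixed period map
`S → 𝔻(I)^λ` sends `Δ` to the type II boundary divisor); Prop. 5.3 (such families exist whose period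
map is a branched cover of an open neighbourhood of the boundary divisor).
Abelian side. Schreieder–Soldatenkov, Thm. 1.2 and the paragraph after it: for a polarized VHS of K3
type over `Δ*` "with associated semi-stable family of Kuga–Satake varieties `α : 𝒜 → Δ`, smooth over
the punctured disc … the semi-stable family `α` … exists after base change … will automatically be
projective over the disc … it is possible to replace the analytic family `α` by an algebraic one
over the formal disc"; Cor. 1.4–1.5 (type II: the Néron special fibre is an extension of an abelian
variety `B` of dimension `2^{r-2}` by a torus `(ℂ*)^{2^{r-2}}`; components birational to
`ℙ`-bundles over `B`); Faltings–Chai, Ch. III (Mumford's relatively complete models over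
higher-dimensional bases). Limit cohomology: Morrison 1984, §2 ("construct a retraction
`r : 𝔛 → 𝔛₀` which induces isomorphisms `r^* : H^m(𝔛₀, ℚ) ≅ H^m(𝔛, ℚ)`") and §3 ("We denote
`H^m(𝔛_t)` by `H^m_lim`, `H^m(𝔛) ≅ H^m(𝔛₀)` by `H^m` … The sequence `H^m → H^m_lim → H^m_lim`
[`i^*`, then `N`] is exact", the local invariant cycle theorem); Steenbrink 1976 (the limit mixed
Hodge structure — NOT recorded here, see below).

The multi-parameter semistable model of `𝒮 ×_M 𝒜` compatible on transversal arcs with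
(Kulikov II) × (Mumford) is not verbatim in print for the (non-PEL) Kuga–Satake family; its
EXISTENCE near general boundary points is therefore a separate, route-side construction statement
(item S5 `BoundaryFamilyModel` of the sketch), to be phrased as `∃ 𝔉 : TypeIIBoundaryFamily B g n`
with the non-degeneracy the consumer needs (e.g. `𝔉.sweep` contains a non-empty open subset of
`M(ℂ)`); by design this file smuggles no existence.

## What is NOT recorded (deliberately; no Lean carrier today)

* d-semistability, `K`-triviality and the stratum description (toric bundles over powers of one
  elliptic curve) of the fibres `Y_b`; what IS available is that every `Y_b` is, as a `ℂ`-scheme,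
  the reduced special fibre of a semistable degeneration (`exists_iso_fiberOver`), hence an snc
  divisor in a regular total space (`LogSmoothDegeneration.isStrictNormalCrossingsDivisor_specialFibre`).
* Projectivity of `π`, of the arc models and of `g` (Mathlib has no projective morphisms; consumers
  add `HodgeTheory.IsQuasiProjectiveOver` on the total spaces, as for `LogSmoothDegeneration`),
  étaleness of `U → M̄`, transversality of the arcs beyond what `IsSemistableDegeneration` forces.
* The limit mixed Hodge structure, `N`, and `H^k(Y₀, Ω^•_{Y₀†/0†}) = H^k_lim` on `Hlim b i` — the
  separate notion `LimitMixedHodgeStructure` (topic `HodgeTheory`); a consumer needing both bridges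
  them by an isomorphism of `ℚ`-spaces compatible with `sp`.
* Any axiom on `tProj` beyond idempotence, any relation between the `lim` of different arcs, and the
  lattice data `(T, I)` of the cusp (the period space `M_T` is not a tree object; `M` is a chart).
* Nothing in the fields is specific to type II: the same structure serves depth-one cusps of other
  types; the name follows the requesting route.

## Sources

* V. Alexeev, P. Engel, *Compact moduli of K3 surfaces*, Ann. of Math. 198 (2023), arXiv:2101.12186,
  Def. 3.1, Thm. 3.2, Prop. 3.4, Thm. 3.8, Thm. 3.17, Def. 3.19, Def. 4.19, Thm. 4.20, Prop. 5.3
  (materialised pp. 10–11, 17, 19–20). [AlexeevEngel2023]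
* S. Schreieder, A. Soldatenkov, *The Kuga–Satake construction under degeneration*, JIMJ 19 (2020),
  arXiv:1710.02102, Thm. 1.1–1.2, Cor. 1.3–1.5 (materialised pp. 3–5). [SchreiederSoldatenkov2019]
* D. R. Morrison, *The Clemens–Schmid exact sequence and applications*, Ann. of Math. Stud. 106
  (1984), §2 (retraction, p. 102), §3 (`H^m_lim`, local invariant cycle theorem, pp. 105–106).
  [Morrison1984ClemensSchmid]
* G. Faltings, C.-L. Chai, *Degeneration of Abelian Varieties* (1990), Ch. III. [FaltingsChai1990]
* A. J. de Jong, *Smoothness, semi-stability and alterations* (1996), 2.16 (through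
  `Motives.LogSmoothDegeneration`). [DeJong1996]
* J. Steenbrink, *Limits of Hodge structures*, Invent. Math. 31 (1976). [Steenbrink1976]
-/

noncomputable section

open CategoryTheory AlgebraicGeometry

namespace Literature.AlgebraicGeometry.Motives

/-- **Boundary family at a depth-one (type II) cusp of the base of an interior family `g : 𝒳 ⟶ M`,
with fibres of dimension `n`, relative to the Betti–Hodge datum `B`** — a hypothesis structure
(data + compatibility axioms, no existence asserted) abstracting Alexeev–Engel, Def. 4.19 ("a family
of d-semistable Kulikov surfaces of Types I + II over a smooth base `S` [whose] discriminant locus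
`Δ ⊂ S` is a smooth divisor", the mixed period map sending `Δ` to the type II boundary divisor,
Thm. 4.20) times the semistable Kuga–Satake family of Schreieder–Soldatenkov, Thm. 1.2, together with
the limit cohomology of Morrison 1984, §3. Fields: a compactification `jM : M ⟶ Mbar` (open
immersion); a smooth irreducible boundary chart `ιU : U ⟶ Mbar` landing off `M`; a flat proper
boundary family `π : Y ⟶ U`; through each `b ∈ U(ℂ)` a non-empty type `Arc b` of transversal arcs
`γ a : C a ⟶ Mbar`, pointed at `o a ↦ ιU b` and interior elsewhere (`c ↦ jM (m a c)`), each with a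
semistable degeneration `D a` over `(C a, o a)` of relative dimension `n` whose special fibre is
`Y_b` (`specialIso`) and whose nearby fibres are the interior fibres `𝒳_{m a c}` (`nearbyIso`); the
limit cohomology `Hlim b i` with `sp : Hⁱ(Y_b) → Hlim b i`, nearby identifications
`ψ : Hⁱ(𝒳_{m a c}) ≃ Hlim b i`, the limit `lim : Hⁱ(𝒳) → Hlim b i` of fibre classes of global
classes, subject to Clemens–Schmid compatibility (`sp_pullback`: `sp (z|_{Y_b}) = ψ (z|_{nearby})`
for `z` a class on the arc model, Morrison §2–3) and `ψ_pullback_fiberι` (`ψ (x|_{𝒳_{m a c}}) = lim x`);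
and an idempotent transcendental-content projector `tProj` on `Hlim b i`. See the module docstring
for what is deliberately not recorded. [cite: AlexeevEngel2023, Def. 4.19, Thm. 4.20, Prop. 5.3 (arXiv:2101.12186)]
[cite: SchreiederSoldatenkov2019, Thm. 1.2 (arXiv:1710.02102)] [cite: Morrison1984ClemensSchmid, §2–§3] -/
structure TypeIIBoundaryFamily (B : BettiHodgeData ℂ) {𝒳 M : SchemeOver ℂ} (g : 𝒳 ⟶ M) (n : ℕ) where
  /-- The compactification `M̄` of the base (intended: a toroidal compactification of the
  lattice-polarized period space, or of the chart `M` over it). -/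
  Mbar : SchemeOver ℂ
  /-- The open immersion `M ↪ M̄`. -/
  jM : M ⟶ Mbar
  /-- `jM` is an open immersion. -/
  isOpenImmersion_jM : IsOpenImmersion jM.left
  /-- The boundary chart `U` (intended: an étale open of the open stratum of the type II boundary
  divisor `B_II(I)`). -/
  U : SchemeOver ℂ
  /-- `U` is smooth over `ℂ` … -/
  smooth_U : Smooth U.hom
  /-- … and irreducible. -/
  irreducibleSpace_U : IrreducibleSpace U.left
  /-- The structure map of the chart to the compactified base, `U → B_II(I) ⊂ M̄`. -/
  ιU : U ⟶ Mbar
  /-- `U` lands in the boundary `M̄ ∖ M`: no complex point of `U` maps to a point of `M`. -/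
  map_ιU_not_mem : ∀ b : ComplexPoints U, AlgPoints.map ιU b ∉ Set.range (AlgPoints.map (L := ℂ) jM)
  /-- The total space of the boundary family (intended: `Y_{0,U}`, the d-semistable `K`-trivial snc
  small resolutions of (Kulikov type II surface) × (Mumford fibre), `b ∈ U`). -/
  Y : SchemeOver ℂ
  /-- The boundary family `π : Y ⟶ U`. -/
  π : Y ⟶ U
  /-- `π` is flat … -/
  flat_π : Flat π.left
  /-- … and proper (projectivity is added by consumers: `HodgeTheory.IsQuasiProjectiveOver Y`). -/
  isProper_π : IsProper π.left
  /-- The type of transversal arcs through the boundary point `b`. -/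
  Arc : ComplexPoints U → Type
  /-- Through every complex point of `U` there is a transversal arc. -/
  arc_nonempty : ∀ b, Nonempty (Arc b)
  /-- The base curve `C` of the arc `a`. -/
  C : ∀ {b : ComplexPoints U}, Arc b → SchemeOver ℂ
  /-- The origin `o ∈ C(ℂ)` of the arc (the point over the boundary). -/
  o : ∀ {b : ComplexPoints U} (a : Arc b), ComplexPoints (C a)
  /-- The arc as a morphism `γ : C ⟶ M̄`. -/
  γ : ∀ {b : ComplexPoints U} (a : Arc b), C a ⟶ Mbar
  /-- The arc passes through the boundary point: `γ(o) = ιU(b)`. -/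
  map_γ_o : ∀ {b : ComplexPoints U} (a : Arc b), AlgPoints.map (γ a) (o a) = AlgPoints.map ιU b
  /-- The interior point `m a c ∈ M(ℂ)` under the nearby point `c ≠ o` of the arc. -/
  m : ∀ {b : ComplexPoints U} (a : Arc b) (c : ComplexPoints (C a)), c ≠ o a → ComplexPoints M
  /-- Off the origin the arc runs in the interior: `γ(c) = jM (m a c)` for `c ≠ o`. -/
  map_γ_eq : ∀ {b : ComplexPoints U} (a : Arc b) (c : ComplexPoints (C a)) (hc : c ≠ o a),
    AlgPoints.map (γ a) c = AlgPoints.map jM (m a c hc)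
  /-- The arc model: a semistable degeneration over `(C, o)` of relative dimension `n` (intended:
  (Kulikov type II model) × (Mumford model of the Kuga–Satake family), small resolution; de Jong
  1996, 2.16; Alexeev–Engel Def. 3.1; Schreieder–Soldatenkov Thm. 1.2). -/
  D : ∀ {b : ComplexPoints U} (a : Arc b), LogSmoothDegeneration (C a).left (o a).pt n
  /-- The boundary family restricts to the arc model: the special fibre of `D a` is `Y_b`. -/
  specialIso : ∀ {b : ComplexPoints U} (a : Arc b), fiberOver (D a).fOver (o a) ≅ fiberOver π b
  /-- The nearby fibres of the arc model are interior fibres: `(D a)_c ≅ 𝒳_{m a c}` for `c ≠ o`. -/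
  nearbyIso : ∀ {b : ComplexPoints U} (a : Arc b) (c : ComplexPoints (C a)) (hc : c ≠ o a),
    fiberOver (D a).fOver c ≅ fiberOver g (m a c hc)
  /-- The limit cohomology `H^i_lim(b)` at the boundary point `b` (Morrison 1984, §3: "we denote
  `H^m(𝔛_t)` by `H^m_lim`"), as `ℚ`-vector spaces. -/
  Hlim : ComplexPoints U → ℕ → ModuleCat.{0} ℚ
  /-- The limit cohomology is finite-dimensional. -/
  finite_Hlim : ∀ (b : ComplexPoints U) (i : ℕ), Module.Finite ℚ (Hlim b i)
  /-- The specialization map `sp : H^i(Y_b) → H^i_lim(b)` (Clemens–Schmid: `i_t^* ∘ (r^*)`,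
  Morrison 1984, §2–§3). -/
  sp : ∀ (b : ComplexPoints U) (i : ℕ), B.W.obj (fiberOver π b) i →ₗ[ℚ] Hlim b i
  /-- The identification of the cohomology of a nearby fibre of the arc `a` with the limit
  cohomology (parallel transport to the reference fibre along a path in the punctured arc). -/
  ψ : ∀ {b : ComplexPoints U} (a : Arc b) (c : ComplexPoints (C a)) (hc : c ≠ o a) (i : ℕ),
    B.W.obj (fiberOver g (m a c hc)) i ≃ₗ[ℚ] Hlim b i
  /-- The limit at `b` along the arc `a` of the fibre classes `s ↦ x|_{𝒳_s}` of a global class `x`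
  of the interior total space (a flat, monodromy-invariant section). -/
  lim : ∀ {b : ComplexPoints U} (a : Arc b) (i : ℕ), B.W.obj 𝒳 i →ₗ[ℚ] Hlim b i
  /-- Fibre classes of a global class have a well-defined limit: `ψ (x|_{𝒳_{m a c}}) = lim x` for
  every nearby point `c` of the arc (Deligne, Hodge II, 4.1.1: restrictions of global classes are
  flat sections). -/
  ψ_pullback_fiberι : ∀ {b : ComplexPoints U} (a : Arc b) (c : ComplexPoints (C a)) (hc : c ≠ o a)
    (i : ℕ) (x : B.W.obj 𝒳 i), ψ a c hc i (B.W.pullback (fiberι g (m a c hc)) i x) = lim a i x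
  /-- Clemens–Schmid compatibility: for a class `z` on the total space of the arc model,
  `sp (z|_{Y_b}) = ψ (z|_{(D a)_c})` for every nearby `c` (Morrison 1984, §2–§3: `r^*` is an
  isomorphism and `H^m(𝔛) → H^m(𝔛_t) = H^m_lim` is `i_t^*`). -/
  sp_pullback : ∀ {b : ComplexPoints U} (a : Arc b) (c : ComplexPoints (C a)) (hc : c ≠ o a) (i : ℕ)
    (z : B.W.obj (D a).over i),
    sp b i (B.W.pullback ((specialIso a).inv ≫ fiberι (D a).fOver (o a)) i z) =
      ψ a c hc i (B.W.pullback ((nearbyIso a c hc).inv ≫ fiberι (D a).fOver c) i z)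
  /-- The transcendental-content projector on `H^i_lim(b)` (intended: the Künneth projector onto
  `T_lim ⊗ H^{i-2}_lim` of the abelian factor). -/
  tProj : ∀ (b : ComplexPoints U) (i : ℕ), Hlim b i →ₗ[ℚ] Hlim b i
  /-- `tProj` is idempotent. -/
  tProj_comp_tProj : ∀ (b : ComplexPoints U) (i : ℕ), tProj b i ∘ₗ tProj b i = tProj b i

namespace TypeIIBoundaryFamily

variable {B : BettiHodgeData ℂ} {𝒳 M : SchemeOver ℂ} {g : 𝒳 ⟶ M} {n : ℕ}
  (𝔉 : TypeIIBoundaryFamily B g n)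

/-- `jM : M ⟶ M̄` is an open immersion (field `isOpenImmersion_jM`, as an instance). [folklore] -/
instance : IsOpenImmersion 𝔉.jM.left := 𝔉.isOpenImmersion_jM

/-- The boundary chart is smooth over `ℂ` (field `smooth_U`, as an instance). [folklore] -/
instance : Smooth 𝔉.U.hom := 𝔉.smooth_U

/-- The boundary chart is irreducible (field `irreducibleSpace_U`, as an instance). [folklore] -/
instance : IrreducibleSpace 𝔉.U.left := 𝔉.irreducibleSpace_U

/-- The boundary family is flat (field `flat_π`, as an instance). [folklore] -/
instance : Flat 𝔉.π.left := 𝔉.flat_π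

/-- The boundary family is proper (field `isProper_π`, as an instance). [folklore] -/
instance : IsProper 𝔉.π.left := 𝔉.isProper_π

/-- The limit cohomology is finite-dimensional (field `finite_Hlim`, as an instance). [folklore] -/
instance (b : ComplexPoints 𝔉.U) (i : ℕ) : Module.Finite ℚ (𝔉.Hlim b i) := 𝔉.finite_Hlim b i

/-! ### The boundary fibres -/

/-- Every boundary fibre `Y_b` is, as a `ℂ`-scheme, the special fibre of a semistable degeneration
of relative dimension `n` over a pointed curve (through the arc that `arc_nonempty` provides); in
particular it is the reduced snc special fibre of a regular total space
(`LogSmoothDegeneration.isStrictNormalCrossingsDivisor_specialFibre`). [folklore] -/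
theorem exists_iso_fiberOver (b : ComplexPoints 𝔉.U) :
    ∃ (C : SchemeOver ℂ) (o : ComplexPoints C) (D : LogSmoothDegeneration C.left o.pt n),
      Nonempty (fiberOver D.fOver o ≅ fiberOver 𝔉.π b) := by
  obtain ⟨a⟩ := 𝔉.arc_nonempty b
  exact ⟨𝔉.C a, 𝔉.o a, 𝔉.D a, ⟨𝔉.specialIso a⟩⟩

/-- The boundary point under `b` is not an interior point. [folklore] -/
theorem map_γ_o_not_mem {b : ComplexPoints 𝔉.U} (a : 𝔉.Arc b) :
    AlgPoints.map (𝔉.γ a) (𝔉.o a) ∉ Set.range (AlgPoints.map (L := ℂ) 𝔉.jM) := by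
  rw [𝔉.map_γ_o a]
  exact 𝔉.map_ιU_not_mem b

/-- Along an arc, the origin is the only point over the boundary: a point `c` of the arc with
`γ(c) ∉ M` is the origin. [folklore] -/
theorem eq_o_of_map_γ_not_mem {b : ComplexPoints 𝔉.U} (a : 𝔉.Arc b) {c : ComplexPoints (𝔉.C a)}
    (hc : AlgPoints.map (𝔉.γ a) c ∉ Set.range (AlgPoints.map (L := ℂ) 𝔉.jM)) : c = 𝔉.o a := by
  by_contra h
  exact hc ⟨𝔉.m a c h, (𝔉.map_γ_eq a c h).symm⟩

/-! ### The interior points swept by the arcs -/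

/-- The **sweep** of the boundary family: the interior points `m a c ∈ M(ℂ)` reached by the nearby
points of its arcs. The route's non-degeneracy condition on an honest boundary family ("`U`
dominant over `B_II(I)`") is that the sweep contains a non-empty open subset of `M(ℂ)`. [folklore] -/
def sweep : Set (ComplexPoints M) :=
  {s | ∃ (b : ComplexPoints 𝔉.U) (a : 𝔉.Arc b) (c : ComplexPoints (𝔉.C a)) (hc : c ≠ 𝔉.o a),
    𝔉.m a c hc = s}

/-- Unfolding lemma for `sweep`. [folklore] -/
theorem mem_sweep_iff (s : ComplexPoints M) :
    s ∈ 𝔉.sweep ↔ ∃ (b : ComplexPoints 𝔉.U) (a : 𝔉.Arc b) (c : ComplexPoints (𝔉.C a))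
      (hc : c ≠ 𝔉.o a), 𝔉.m a c hc = s :=
  Iff.rfl

/-- The interior points of an arc lie in the sweep. [folklore] -/
theorem m_mem_sweep {b : ComplexPoints 𝔉.U} (a : 𝔉.Arc b) (c : ComplexPoints (𝔉.C a))
    (hc : c ≠ 𝔉.o a) : 𝔉.m a c hc ∈ 𝔉.sweep :=
  ⟨b, a, c, hc, rfl⟩

/-- The interior points of an arc are points of `M` inside `M̄`: `γ(c) ∈ jM(M(ℂ))`. [folklore] -/
theorem map_γ_mem_range {b : ComplexPoints 𝔉.U} (a : 𝔉.Arc b) (c : ComplexPoints (𝔉.C a))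
    (hc : c ≠ 𝔉.o a) : AlgPoints.map (𝔉.γ a) c ∈ Set.range (AlgPoints.map (L := ℂ) 𝔉.jM) :=
  ⟨𝔉.m a c hc, (𝔉.map_γ_eq a c hc).symm⟩

/-- The boundary family **sweeps an open set**: its sweep contains a non-empty open subset of
`M(ℂ)` (analytic topology of `Motives.ComplexPoints`). This is the non-degeneracy an honest
boundary family near a general boundary point has (Alexeev–Engel, Prop. 5.3: the mixed period map
of the family covers an open neighbourhood of the boundary divisor, so the transversal arcs
through `U` fill an open set of the interior) and the hypothesis a spreading step consumes; the
degenerate inhabitants of the structure (no nearby points on any arc) fail it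
(`not_isSweeping_of_sweep_eq_empty`). [cite: AlexeevEngel2023, Prop. 5.3 (arXiv:2101.12186)] -/
def IsSweeping (𝔉 : TypeIIBoundaryFamily B g n) : Prop :=
  ∃ V : Set (ComplexPoints M), IsOpen V ∧ V.Nonempty ∧ V ⊆ 𝔉.sweep

/-- A sweeping boundary family has a non-empty sweep: some arc has a nearby point. [folklore] -/
theorem IsSweeping.sweep_nonempty (h : 𝔉.IsSweeping) : 𝔉.sweep.Nonempty := by
  obtain ⟨V, -, hV, hVs⟩ := h
  exact hV.mono hVs

/-- A boundary family none of whose arcs has a nearby point is not sweeping. [folklore] -/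
theorem not_isSweeping_of_sweep_eq_empty (h : 𝔉.sweep = ∅) : ¬ 𝔉.IsSweeping := fun hs => by
  simpa [h] using hs.sweep_nonempty

/-! ### Restriction of classes on an arc model to its special and nearby fibres -/

/-- Restriction of a class on the total space of the arc model `D a` to the boundary fibre `Y_b`
(through `specialIso`). [folklore] -/
def toSpecialFibre {b : ComplexPoints 𝔉.U} (a : 𝔉.Arc b) (i : ℕ) :
    B.W.obj (𝔉.D a).over i →ₗ[ℚ] B.W.obj (fiberOver 𝔉.π b) i :=
  B.W.pullback ((𝔉.specialIso a).inv ≫ fiberι (𝔉.D a).fOver (𝔉.o a)) i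

/-- Restriction of a class on the total space of the arc model `D a` to the interior fibre
`𝒳_{m a c}` over a nearby point `c ≠ o` (through `nearbyIso`). [folklore] -/
def toNearbyFibre {b : ComplexPoints 𝔉.U} (a : 𝔉.Arc b) (c : ComplexPoints (𝔉.C a))
    (hc : c ≠ 𝔉.o a) (i : ℕ) :
    B.W.obj (𝔉.D a).over i →ₗ[ℚ] B.W.obj (fiberOver g (𝔉.m a c hc)) i :=
  B.W.pullback ((𝔉.nearbyIso a c hc).inv ≫ fiberι (𝔉.D a).fOver c) i

/-- Unfolding lemma for `toSpecialFibre`. [folklore] -/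
theorem toSpecialFibre_apply {b : ComplexPoints 𝔉.U} (a : 𝔉.Arc b) (i : ℕ)
    (z : B.W.obj (𝔉.D a).over i) :
    𝔉.toSpecialFibre a i z =
      B.W.pullback ((𝔉.specialIso a).inv ≫ fiberι (𝔉.D a).fOver (𝔉.o a)) i z :=
  rfl

/-- Unfolding lemma for `toNearbyFibre`. [folklore] -/
theorem toNearbyFibre_apply {b : ComplexPoints 𝔉.U} (a : 𝔉.Arc b) (c : ComplexPoints (𝔉.C a))
    (hc : c ≠ 𝔉.o a) (i : ℕ) (z : B.W.obj (𝔉.D a).over i) :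
    𝔉.toNearbyFibre a c hc i z = B.W.pullback ((𝔉.nearbyIso a c hc).inv ≫ fiberι (𝔉.D a).fOver c) i z :=
  rfl

/-- The fibre class `x|_{𝒳_s}` of a global class of the interior total space. [folklore] -/
abbrev fibreClass (i : ℕ) (x : B.W.obj 𝒳 i) (s : ComplexPoints M) : B.W.obj (fiberOver g s) i :=
  B.W.pullback (fiberι g s) i x

/-! ### Specialization and limits -/

/-- Clemens–Schmid compatibility in terms of the restriction maps: `sp (z|_{Y_b}) = ψ (z|_{(D a)_c})`.
[cite: Morrison1984ClemensSchmid, §3] -/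
theorem sp_toSpecialFibre {b : ComplexPoints 𝔉.U} (a : 𝔉.Arc b) {c : ComplexPoints (𝔉.C a)}
    (hc : c ≠ 𝔉.o a) (i : ℕ) (z : B.W.obj (𝔉.D a).over i) :
    𝔉.sp b i (𝔉.toSpecialFibre a i z) = 𝔉.ψ a c hc i (𝔉.toNearbyFibre a c hc i z) :=
  𝔉.sp_pullback a c hc i z

/-- The limit of the fibre classes of a global class does not depend on the nearby point used to
compute it. [folklore] -/
theorem ψ_fibreClass_eq_ψ_fibreClass {b : ComplexPoints 𝔉.U} (a : 𝔉.Arc b)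
    {c c' : ComplexPoints (𝔉.C a)} (hc : c ≠ 𝔉.o a) (hc' : c' ≠ 𝔉.o a) (i : ℕ) (x : B.W.obj 𝒳 i) :
    𝔉.ψ a c hc i (fibreClass i x (𝔉.m a c hc)) = 𝔉.ψ a c' hc' i (fibreClass i x (𝔉.m a c' hc')) := by
  rw [fibreClass, fibreClass, 𝔉.ψ_pullback_fiberι, 𝔉.ψ_pullback_fiberι]

/-- **The specialization of a flat limit is the limit of the flat class.** If a class `z` on the
total space of the arc model restricts on ONE nearby fibre `(D a)_c ≅ 𝒳_{m a c}` to the fibre class of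
a global class `x` of the interior family, then the specialization of its restriction to the
boundary fibre `Y_b` is the limit of the fibre classes of `x`. This is the axiom the requesting route
asked for ("`sp (ch` of a flat limit`)` = limit of the flat class"): with `z = ch(E)` for a perfect
complex `E` on the arc model and `x` a global class with `ch(E|_{(D a)_c}) = x|_{𝒳_{m a c}}`, it reads
`sp (ch(E|_{Y_b})) = lim x` once a Chern character natural under restriction is available
(definition request `PerfectComplexOnSNC`). [cite: Morrison1984ClemensSchmid, §2–§3] -/
theorem sp_toSpecialFibre_eq_lim {b : ComplexPoints 𝔉.U} (a : 𝔉.Arc b) {c : ComplexPoints (𝔉.C a)}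
    (hc : c ≠ 𝔉.o a) (i : ℕ) {z : B.W.obj (𝔉.D a).over i} {x : B.W.obj 𝒳 i}
    (h : 𝔉.toNearbyFibre a c hc i z = fibreClass i x (𝔉.m a c hc)) :
    𝔉.sp b i (𝔉.toSpecialFibre a i z) = 𝔉.lim a i x := by
  rw [𝔉.sp_toSpecialFibre a hc, h, fibreClass, 𝔉.ψ_pullback_fiberι]

/-- Two classes on the arc model with the same restriction to one nearby fibre have the same
specialization of their boundary restrictions (`ψ` is injective). [folklore] -/
theorem sp_toSpecialFibre_eq_of_toNearbyFibre_eq {b : ComplexPoints 𝔉.U} (a : 𝔉.Arc b)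
    {c : ComplexPoints (𝔉.C a)} (hc : c ≠ 𝔉.o a) (i : ℕ) {z z' : B.W.obj (𝔉.D a).over i}
    (h : 𝔉.toNearbyFibre a c hc i z = 𝔉.toNearbyFibre a c hc i z') :
    𝔉.sp b i (𝔉.toSpecialFibre a i z) = 𝔉.sp b i (𝔉.toSpecialFibre a i z') := by
  rw [𝔉.sp_toSpecialFibre a hc, 𝔉.sp_toSpecialFibre a hc, h]

/-! ### Transcendental content -/

/-- `tProj` is idempotent, pointwise. [folklore] -/
@[simp]
theorem tProj_tProj (b : ComplexPoints 𝔉.U) (i : ℕ) (y : 𝔉.Hlim b i) :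
    𝔉.tProj b i (𝔉.tProj b i y) = 𝔉.tProj b i y :=
  LinearMap.congr_fun (𝔉.tProj_comp_tProj b i) y

/-- A class `y ∈ H^i(Y_b)` on a boundary fibre **has non-zero transcendental content** if the
transcendental-content projection of its specialization is non-zero (the route's "`T`-content of
`E_b` is non-zero", for `y = ch_i(E_b)`). [folklore] -/
def HasTranscendentalContent (b : ComplexPoints 𝔉.U) (i : ℕ) (y : B.W.obj (fiberOver 𝔉.π b) i) :
    Prop :=
  𝔉.tProj b i (𝔉.sp b i y) ≠ 0

/-- Unfolding lemma for `HasTranscendentalContent`. [folklore] -/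
theorem hasTranscendentalContent_iff (b : ComplexPoints 𝔉.U) (i : ℕ)
    (y : B.W.obj (fiberOver 𝔉.π b) i) :
    𝔉.HasTranscendentalContent b i y ↔ 𝔉.tProj b i (𝔉.sp b i y) ≠ 0 :=
  Iff.rfl

/-- The zero class has no transcendental content (so the predicate is not vacuously satisfiable).
[folklore] -/
theorem not_hasTranscendentalContent_zero (b : ComplexPoints 𝔉.U) (i : ℕ) :
    ¬ 𝔉.HasTranscendentalContent b i 0 := by
  simp [HasTranscendentalContent]

/-- Transcendental content is detected in the image of `tProj`: a class whose specialization is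
killed by `tProj` has none, and `y` has transcendental content iff the `tProj`-component of
`sp y` does. [folklore] -/
theorem hasTranscendentalContent_iff_of_eq {b : ComplexPoints 𝔉.U} {i : ℕ}
    {y y' : B.W.obj (fiberOver 𝔉.π b) i}
    (h : 𝔉.tProj b i (𝔉.sp b i y) = 𝔉.tProj b i (𝔉.sp b i y')) :
    𝔉.HasTranscendentalContent b i y ↔ 𝔉.HasTranscendentalContent b i y' := by
  rw [hasTranscendentalContent_iff, hasTranscendentalContent_iff, h]

end TypeIIBoundaryFamily

end Literature.AlgebraicGeometry.Motives

end
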